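import Literature.NumberTheory.EllipticCurves.ZpExtensionAnticyclotomicHoldsProofs
import HarnessLib

/-!
# X11b @ `p = 3`, S24-a (λ-supply), part (E): the `ℤ_p`-rank-two algebra —
# "an anti-invariant character through `K̃_∞` factors through the anticyclotomic `ℤ_p`-extension"

HONEST FRAMING (cell `b2b-bsdres`, run/shared/lean/b2b/bsd-rank1-residual/, verbatim in every
file): the goal of the cell is to DELETE the COMBINATION-SHAPED residual classes of the
Birch–Swinnerton-Dyer formula for ALL analytic-rank `≤ 1` elliptic curves over `ℚ` — assembled
STRICTLY from published theorems — so that the rank-`≤ 1` remainder becomes exactly the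
CONSTRUCTION-SHAPED classes, which are TYPED, NOT attempted. This is not "finishing BSD". Team N8/O2
(X11b at `3`: `3 ‖ N`, `r_an = 1`, `E[3]` irreducible): research route; nothing booked; NO label
changes; O2 stays OPEN. THEOREMS ONLY (pure algebra + the tree's PROVED `ℤ_p`-rank facts); no fact,
no `sorry`.

PROVENANCE: sub-target S24 'λ-SUPPLY SPLIT' (OWNERS R7-59, lead x11b3 GEN 6), seat
`b2b-bsdres-x11b3-p7` (gen. 4); feasibility census `HOME/b2b-bsdres-x11b3-p7/s24/S24-FEASIBILITY.md`,
step (E) "LEMMA Λ′" of the λ-supply theorem (the (λ)-conjunct of `Three.HsiehFrameResidualAt₃`). L58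
(lit1) sources this step to Cornut–Vatsal 2007, Cor. 2.2 and Cox, Thm. 9.18; in the tree it follows
from the PROVED `ℤ_p`-rank facts `Gal(K̃/K) ≃ ℤ_p²`, `Gal(ℚ̃/ℚ) ≃ ℤ_p`
(`ZpExtension.zpRank_eq_nrComplexPlaces_add_one`, discharged as in `exists_isAnticyclotomic_holds`).

## What this file proves (every prime `p`; `K : Type` imaginary quadratic)

With `κ : Γ_K ↠ ℤ_p` anticyclotomic, `c ∈ Γ_ℚ ∖ res(Γ_K)` an involution, `θ` the lift of conjugation by
`c` to `Γ_K` (`IndexTwo.exists_conjHom`) and `Φ₀, Φ₁` a jointly surjective spanning pair of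
`Hom_cont(Γ_K, ℤ_p)` (`exists_spanningPair`; common kernel `N = Gal(K̄/K̃_∞)`):
* `apply_conj_eq_of_apply_eq_one` (**LEMMA Λ′, core**): `Φᵢ(θσ) = Φᵢ(σ)` for `σ ∈ ker κ` — `θ` acts
  trivially on `Gal(K̃_∞/K_∞^{ac})`. `2 × 2` linear algebra over the domain `ℤ_p`
  (`Matrix22.mulVec_eq_self_of_row`): `θ*` is a matrix `A`, `A² = 1`; the row `k` of `κ` is unimodular
  with `kA = −k`; the restriction of the `ℤ_p`-character of `Γ_ℚ` is a NON-ZERO row `γ` with `γA = γ`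
  (`exists_invariant_ne_one`); hence `A w = w` whenever `k · w = 0`.
* `mul_self_eq_one_of_anti`, `apply_eq_one_of_anti` (**LEMMA Λ′**): a homomorphism `g : Γ_K → M`
  killing `N` with `g(θσ) = g(σ)⁻¹` has `g(σ)² = 1` on `ker κ`, so kills `ker κ` when its values there
  have no `2`-torsion (principal units of `ℚ̄_p`, `p` odd) — the `FactorsThroughZp κ` shape needed
  for the avatar of the auxiliary Hecke character `λ` (census §2 (D)–(F)).

## References

* [Greenberg1987] R. Greenberg, *Non-vanishing of certain values of `L`-functions*, Progr. Math. 70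
  (1987), §2 (complex conjugation acts on `Gal(K̃_∞/K) ≃ ℤ_p²` with eigenvalues `±1`).
* [Washington1997] L. C. Washington, *Introduction to Cyclotomic Fields*, 2nd ed., §13.1, Thm. 13.4.
* [CornutVatsal2007] C. Cornut, V. Vatsal, *L-functions and Galois representations* (2007), Cor. 2.2.
-/

noncomputable section

namespace Summit.BirchSwinnertonDyer.Rank1Residual.X11b.Three.LambdaSupply

/-! ### §1. `2 × 2` linear algebra over a domain of characteristic zero -/

section Matrix22

variable {R : Type*} [CommRing R] [IsDomain R] [CharZero R]

omit [IsDomain R] [CharZero R] in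
/-- **Kernel of a unimodular row is a line.** If `k₀ x + k₁ y = 1` and `k₀ w₀ + k₁ w₁ = 0` then
`(w₀, w₁) = t · (k₁, −k₀)` with `t = y w₀ − x w₁`. [folklore] -/
theorem Matrix22.ker_row_eq_smul {k₀ k₁ x y w₀ w₁ : R} (hxy : k₀ * x + k₁ * y = 1)
    (hw : k₀ * w₀ + k₁ * w₁ = 0) :
    w₀ = (y * w₀ - x * w₁) * k₁ ∧ w₁ = -((y * w₀ - x * w₁) * k₀) := by
  constructor
  · linear_combination (-w₀) * hxy + x * hw
  · linear_combination (-w₁) * hxy + y * hw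

omit [IsDomain R] [CharZero R] in
/-- **A row orthogonal to `(k₁, −k₀)` is a multiple of the unimodular row `(k₀, k₁)`.** [folklore] -/
theorem Matrix22.row_eq_smul_of_orth {k₀ k₁ x y γ₀ γ₁ : R} (hxy : k₀ * x + k₁ * y = 1)
    (h : γ₀ * k₁ - γ₁ * k₀ = 0) :
    γ₀ = (γ₀ * x + γ₁ * y) * k₀ ∧ γ₁ = (γ₀ * x + γ₁ * y) * k₁ := by
  constructor
  · linear_combination (-γ₀) * hxy + y * h
  · linear_combination (-γ₁) * hxy + (-x) * h

/-- **LEMMA Λ′, matrix form.** Let `A = (aᵢⱼ)` be a `2 × 2` matrix over a domain `R` of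
characteristic `0` with `A² = 1`; let `k = (k₀, k₁)` be a unimodular row (`k₀x + k₁y = 1`) with
`kA = −k`, and `γ` a non-zero row with `γA = γ`. Then `A` fixes every column `w` with `k · w = 0`:
`A w = w`. Proof: `ker k` is the line through `w⁰ = (k₁, −k₀)`; `k · (A w⁰) = (kA) · w⁰ = 0`, so
`A w⁰ = s w⁰`, and `A² = 1` forces `s = ±1`; if `s = −1` then `γ · w⁰ = γ · (A w⁰)·(−1) = −(γA) · w⁰ =
−γ · w⁰`, so `γ · w⁰ = 0`, `γ` is a multiple of `k`, `γ = γA = −γ`, `γ = 0` — contradiction.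
(Greenberg 1987 §2: the `±1`-eigenlines of complex conjugation on `ℤ_p²`.) [cite: Greenberg1987, §2] -/
theorem Matrix22.mulVec_eq_self_of_row {a₀₀ a₀₁ a₁₀ a₁₁ k₀ k₁ x y γ₀ γ₁ : R}
    (hA₀₀ : a₀₀ * a₀₀ + a₀₁ * a₁₀ = 1) (hA₀₁ : a₀₀ * a₀₁ + a₀₁ * a₁₁ = 0)
    (hA₁₀ : a₁₀ * a₀₀ + a₁₁ * a₁₀ = 0) (hA₁₁ : a₁₀ * a₀₁ + a₁₁ * a₁₁ = 1)
    (hk₀ : k₀ * a₀₀ + k₁ * a₁₀ = -k₀) (hk₁ : k₀ * a₀₁ + k₁ * a₁₁ = -k₁)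
    (hxy : k₀ * x + k₁ * y = 1)
    (hγ₀ : γ₀ * a₀₀ + γ₁ * a₁₀ = γ₀) (hγ₁ : γ₀ * a₀₁ + γ₁ * a₁₁ = γ₁) (hγ : γ₀ ≠ 0 ∨ γ₁ ≠ 0)
    {w₀ w₁ : R} (hw : k₀ * w₀ + k₁ * w₁ = 0) :
    a₀₀ * w₀ + a₀₁ * w₁ = w₀ ∧ a₁₀ * w₀ + a₁₁ * w₁ = w₁ := by
  -- the image `(P, Q) = A w⁰` of the generator `w⁰ = (k₁, -k₀)` of `ker k`
  set P : R := a₀₀ * k₁ - a₀₁ * k₀ with hP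
  set Q : R := a₁₀ * k₁ - a₁₁ * k₀ with hQ
  -- `k · (A w⁰) = 0`
  have hkPQ : k₀ * P + k₁ * Q = 0 := by
    rw [hP, hQ]; linear_combination k₁ * hk₀ - k₀ * hk₁
  -- so `A w⁰ = s w⁰`
  obtain ⟨hPs, hQs⟩ := Matrix22.ker_row_eq_smul hxy hkPQ
  set s : R := y * P - x * Q with hs
  -- `A² = 1` gives `s² = 1`
  have hAP : a₀₀ * P + a₀₁ * Q = k₁ := by
    rw [hP, hQ]; linear_combination k₁ * hA₀₀ - k₀ * hA₀₁
  have hAQ : a₁₀ * P + a₁₁ * Q = -k₀ := by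
    rw [hP, hQ]; linear_combination k₁ * hA₁₀ - k₀ * hA₁₁
  have hs2k₁ : (s * s - 1) * k₁ = 0 := by
    linear_combination s * hP + (-a₀₀ - s) * hPs + (-a₀₁) * hQs + hAP
  have hs2k₀ : (s * s - 1) * k₀ = 0 := by
    linear_combination (-s) * hQ + a₁₀ * hPs + (a₁₁ + s) * hQs - hAQ
  have hs2 : s * s = 1 := by
    linear_combination x * hs2k₀ + y * hs2k₁ - (s * s - 1) * hxy
  -- exclude `s = -1` using the non-zero invariant row `γ`
  have hs1 : s = 1 := by
    rcases mul_self_eq_one_iff.mp hs2 with h | h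
    · exact h
    · exfalso
      -- `γ · (A w⁰) = (γ A) · w⁰ = γ · w⁰`, and `A w⁰ = -w⁰`
      have hγw : γ₀ * P + γ₁ * Q = γ₀ * k₁ - γ₁ * k₀ := by
        rw [hP, hQ]; linear_combination k₁ * hγ₀ - k₀ * hγ₁
      have hPneg : P = -k₁ := by rw [hPs, h]; ring
      have hQneg : Q = k₀ := by rw [hQs, h]; ring
      have horth : γ₀ * k₁ - γ₁ * k₀ = 0 := by
        have h2 : (2 : R) * (γ₀ * k₁ - γ₁ * k₀) = 0 := by
          linear_combination -hγw + γ₀ * hPneg + γ₁ * hQneg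
        exact (mul_eq_zero.mp h2).resolve_left two_ne_zero
      -- so `γ = λ k`, hence `γ A = -γ = γ`, `γ = 0`
      obtain ⟨hγ₀', hγ₁'⟩ := Matrix22.row_eq_smul_of_orth hxy horth
      set l : R := γ₀ * x + γ₁ * y with hl
      have hγA₀ : γ₀ * a₀₀ + γ₁ * a₁₀ = -γ₀ := by
        rw [hγ₀', hγ₁']; linear_combination l * hk₀
      have h20 : (2 : R) * γ₀ = 0 := by linear_combination hγA₀ - hγ₀
      have hγA₁ : γ₀ * a₀₁ + γ₁ * a₁₁ = -γ₁ := by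
        rw [hγ₀', hγ₁']; linear_combination l * hk₁
      have h21 : (2 : R) * γ₁ = 0 := by linear_combination hγA₁ - hγ₁
      have hz₀ : γ₀ = 0 := (mul_eq_zero.mp h20).resolve_left two_ne_zero
      have hz₁ : γ₁ = 0 := (mul_eq_zero.mp h21).resolve_left two_ne_zero
      exact hγ.elim (fun h => h hz₀) (fun h => h hz₁)
  -- conclude: `A w⁰ = w⁰`, hence `A w = w` on the whole line `ker k`
  have hP1 : P = k₁ := by rw [hPs, hs1, one_mul]
  have hQ1 : Q = -k₀ := by rw [hQs, hs1, one_mul]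
  obtain ⟨hw₀, hw₁⟩ := Matrix22.ker_row_eq_smul hxy hw
  set t : R := y * w₀ - x * w₁ with ht
  constructor
  · linear_combination t * hP1 + (a₀₀ - 1) * hw₀ + a₀₁ * hw₁ - t * hP
  · linear_combination t * hQ1 + a₁₀ * hw₀ + (a₁₁ - 1) * hw₁ - t * hQ

end Matrix22

/-! ### §2. The core lemma for an abstract compact group with a rank-two spanning pair -/

section Core

open Literature.NumberTheory.EllipticCurves

variable {H : Type*} [Group H] [TopologicalSpace H] {p : ℕ} [Fact p.Prime]

/-- Coefficients with respect to a jointly surjective pair are unique: if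
`a Φ₀(σ) + b Φ₁(σ) = a' Φ₀(σ) + b' Φ₁(σ)` for all `σ` then `a = a'` and `b = b'` (evaluate at preimages
of `(1,0)` and `(0,1)`). [folklore] -/
theorem coeff_unique (Φ₀ Φ₁ : H →ₜ* Multiplicative ℤ_[p])
    (hsurj : Function.Surjective fun σ => ((Φ₀ σ).toAdd, (Φ₁ σ).toAdd)) {a b a' b' : ℤ_[p]}
    (h : ∀ σ, a * (Φ₀ σ).toAdd + b * (Φ₁ σ).toAdd = a' * (Φ₀ σ).toAdd + b' * (Φ₁ σ).toAdd) :
    a = a' ∧ b = b' := by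
  obtain ⟨σa, hσa⟩ := hsurj (1, 0)
  obtain ⟨σb, hσb⟩ := hsurj (0, 1)
  simp only [Prod.mk.injEq] at hσa hσb
  constructor
  · simpa only [hσa.1, hσa.2, mul_one, mul_zero, add_zero] using h σa
  · simpa only [hσb.1, hσb.2, mul_one, mul_zero, zero_add] using h σb

/-- **LEMMA Λ′ (core, abstract).** Let `H` be a topological group with a jointly surjective pair
`Φ₀, Φ₁ : H →ₜ* ℤ_p` spanning `Hom_cont(H, ℤ_p)`; `θ : H →ₜ* H` an involution; `κ : H →ₜ* ℤ_p`
surjective and `θ`-ANTI-invariant; and suppose some `θ`-INVARIANT `gp : H →ₜ* ℤ_p` is non-trivial.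
Then `θ` acts trivially on `ker κ` modulo `ker Φ₀ ∩ ker Φ₁`: `Φᵢ(θσ) = Φᵢ(σ)` for `σ ∈ ker κ`.
(`Matrix22.mulVec_eq_self_of_row` applied to the matrix of `θ*` in the basis `(Φ₀, Φ₁)`.)
[cite: Greenberg1987, §2] -/
theorem apply_conj_eq_of_apply_eq_one_core (θ : H →ₜ* H) (hθθ : ∀ σ, θ (θ σ) = σ)
    (Φ₀ Φ₁ : H →ₜ* Multiplicative ℤ_[p])
    (hsurj : Function.Surjective fun σ => ((Φ₀ σ).toAdd, (Φ₁ σ).toAdd))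
    (hspan : ∀ f : H →ₜ* Multiplicative ℤ_[p], ∃ a b : ℤ_[p],
      ∀ σ, (f σ).toAdd = a * (Φ₀ σ).toAdd + b * (Φ₁ σ).toAdd)
    (κ : H →ₜ* Multiplicative ℤ_[p]) (hκ : Function.Surjective κ) (hκθ : ∀ σ, κ (θ σ) = (κ σ)⁻¹)
    (gp : H →ₜ* Multiplicative ℤ_[p]) (hgp : gp ≠ 1) (hgpθ : ∀ σ, gp (θ σ) = gp σ)
    {σ : H} (hσ : κ σ = 1) : Φ₀ (θ σ) = Φ₀ σ ∧ Φ₁ (θ σ) = Φ₁ σ := by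
  -- the matrix `A` of `θ*`: `Φᵢ ∘ θ = aᵢ₀ Φ₀ + aᵢ₁ Φ₁`
  obtain ⟨a₀₀, a₀₁, hA₀'⟩ := hspan (Φ₀.comp θ)
  obtain ⟨a₁₀, a₁₁, hA₁'⟩ := hspan (Φ₁.comp θ)
  have hA₀ : ∀ τ, (Φ₀ (θ τ)).toAdd = a₀₀ * (Φ₀ τ).toAdd + a₀₁ * (Φ₁ τ).toAdd := fun τ => hA₀' τ
  have hA₁ : ∀ τ, (Φ₁ (θ τ)).toAdd = a₁₀ * (Φ₀ τ).toAdd + a₁₁ * (Φ₁ τ).toAdd := fun τ => hA₁' τ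
  -- rows of `κ` and `gp`
  obtain ⟨k₀, k₁, hk⟩ := hspan κ
  obtain ⟨γ₀, γ₁, hγ⟩ := hspan gp
  -- `A² = 1`
  have hAA₀ := coeff_unique Φ₀ Φ₁ hsurj (a := a₀₀ * a₀₀ + a₀₁ * a₁₀) (b := a₀₀ * a₀₁ + a₀₁ * a₁₁)
    (a' := 1) (b' := 0) (fun τ => by
      have h := hA₀ (θ τ)
      rw [hθθ, hA₀ τ, hA₁ τ] at h
      linear_combination -h)
  have hAA₁ := coeff_unique Φ₀ Φ₁ hsurj (a := a₁₀ * a₀₀ + a₁₁ * a₁₀) (b := a₁₀ * a₀₁ + a₁₁ * a₁₁)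
    (a' := 0) (b' := 1) (fun τ => by
      have h := hA₁ (θ τ)
      rw [hθθ, hA₀ τ, hA₁ τ] at h
      linear_combination -h)
  -- `k A = -k`
  have hkA := coeff_unique Φ₀ Φ₁ hsurj (a := k₀ * a₀₀ + k₁ * a₁₀) (b := k₀ * a₀₁ + k₁ * a₁₁)
    (a' := -k₀) (b' := -k₁) (fun τ => by
      have h := hk (θ τ)
      rw [hκθ, toAdd_inv, hk τ, hA₀ τ, hA₁ τ] at h
      linear_combination -h)
  -- `γ A = γ`, `γ ≠ 0`
  have hγA := coeff_unique Φ₀ Φ₁ hsurj (a := γ₀ * a₀₀ + γ₁ * a₁₀) (b := γ₀ * a₀₁ + γ₁ * a₁₁)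
    (a' := γ₀) (b' := γ₁) (fun τ => by
      have h := hγ (θ τ)
      rw [hgpθ, hγ τ, hA₀ τ, hA₁ τ] at h
      linear_combination -h)
  have hγne : γ₀ ≠ 0 ∨ γ₁ ≠ 0 := by
    rcases ne_or_eq γ₀ 0 with h0 | h0
    · exact Or.inl h0
    rcases ne_or_eq γ₁ 0 with h1 | h1
    · exact Or.inr h1
    exfalso
    apply hgp
    ext τ
    have := hγ τ
    rw [h0, h1, zero_mul, zero_mul, add_zero] at this
    change gp τ = 1
    exact Multiplicative.toAdd.injective (by rw [toAdd_one]; exact this)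
  -- `k` is unimodular: `κ(σ₁) = 1 ∈ ℤ_p`
  obtain ⟨σ₁, hσ₁⟩ := hκ (Multiplicative.ofAdd 1)
  have hxy : k₀ * (Φ₀ σ₁).toAdd + k₁ * (Φ₁ σ₁).toAdd = 1 := by rw [← hk σ₁, hσ₁, toAdd_ofAdd]
  -- the column `w = (Φ₀ σ, Φ₁ σ)` lies in `ker k`
  have hw : k₀ * (Φ₀ σ).toAdd + k₁ * (Φ₁ σ).toAdd = 0 := by rw [← hk σ, hσ, toAdd_one]
  obtain ⟨h₀, h₁⟩ := Matrix22.mulVec_eq_self_of_row hAA₀.1 hAA₀.2 hAA₁.1 hAA₁.2 hkA.1 hkA.2 hxy hγA.1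
    hγA.2 hγne hw
  refine ⟨Multiplicative.toAdd.injective ?_, Multiplicative.toAdd.injective ?_⟩
  · rw [hA₀ σ]; exact h₀
  · rw [hA₁ σ]; exact h₁

end Core

/-! ### §3. The number-field specialisation: `K` imaginary quadratic -/

section NumberField

open Literature.NumberTheory.EllipticCurves Literature.NumberTheory.EllipticCurves.ZpExtension
  Literature.NumberTheory.GaloisRepresentations NumberField NumberField.InfinitePlace Field

variable {K : Type} [Field K] [NumberField K] {p : ℕ} [Fact p.Prime]

/-- **A spanning pair for `Hom_cont(Γ_K, ℤ_p)`, `K` imaginary quadratic** (`Gal(K̃/K) ≃ ℤ_p²`): there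
are `Φ₀, Φ₁ : Γ_K →ₜ* ℤ_p`, jointly surjective, such that every continuous `f : Γ_K →ₜ* ℤ_p` is
`a Φ₀ + b Φ₁`. This is the tree's PROVED `ℤ_p`-rank fact `zpRank_eq_nrComplexPlaces_add_one K p` (unit
rank `0`, `r₂ = 1`; Washington Thm. 13.4 / Lang Thm. 5.2, discharged through the global reciprocity
law `exists_isGlobalReciprocityMap_holds` as in `exists_isAnticyclotomic_holds`), unpacked at `r₂ + 1 = 2`.
[cite: Washington1997, Thm. 13.4] -/
theorem exists_spanningPair (hK : Module.finrank ℚ K = 2) (himag : ∀ w : InfinitePlace K, w.IsComplex) :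
    ∃ Φ₀ Φ₁ : absoluteGaloisGroup K →ₜ* Multiplicative ℤ_[p],
      (Function.Surjective fun σ => ((Φ₀ σ).toAdd, (Φ₁ σ).toAdd)) ∧
      ∀ f : absoluteGaloisGroup K →ₜ* Multiplicative ℤ_[p], ∃ a b : ℤ_[p],
        ∀ σ, (f σ).toAdd = a * (Φ₀ σ).toAdd + b * (Φ₁ σ).toAdd := by
  classical
  have hfact : zpRank_eq_nrComplexPlaces_add_one K p :=
    zpRank_eq_nrComplexPlaces_add_one_of_globalReciprocity₀ fun K₀ _ _ _ _ =>
      Literature.NumberTheory.GaloisRepresentations.exists_isGlobalReciprocityMap_holds K₀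
  obtain ⟨Φ, hsurj, hspan⟩ := hfact (units_rank_eq_zero_of_finrank_eq_two hK himag)
  have h1 := nrComplexPlaces_eq_one_of_finrank_eq_two hK himag
  let i₀ : Fin (nrComplexPlaces K + 1) := ⟨0, Nat.succ_pos _⟩
  let i₁ : Fin (nrComplexPlaces K + 1) := ⟨1, by omega⟩
  have hne : i₁ ≠ i₀ := fun h => absurd (congrArg Fin.val h) Nat.one_ne_zero
  have huniv : (Finset.univ : Finset (Fin (nrComplexPlaces K + 1))) = {i₀, i₁} := by
    ext i
    simp only [Finset.mem_univ, Finset.mem_insert, Finset.mem_singleton, true_iff]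
    have hi : i.val < nrComplexPlaces K + 1 := i.isLt
    rcases Nat.lt_or_ge i.val 1 with h0 | h0
    · left; exact Fin.ext (by show i.val = 0; omega)
    · right; exact Fin.ext (by show i.val = 1; omega)
  refine ⟨Φ i₀, Φ i₁, fun xy => ?_, fun f => ?_⟩
  · obtain ⟨σ, hσ⟩ := hsurj (fun i => if i = i₀ then xy.1 else xy.2)
    refine ⟨σ, Prod.ext ?_ ?_⟩
    · have h0 := congrFun hσ i₀
      rw [if_pos rfl] at h0
      exact h0
    · have h1' := congrFun hσ i₁
      rw [if_neg hne] at h1'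
      exact h1'
  · obtain ⟨a, ha⟩ := hspan f
    refine ⟨a i₀, a i₁, fun σ => ?_⟩
    rw [ha σ, huniv, Finset.sum_pair hne.symm]

/-- **A non-zero `θ`-invariant character of `Γ_K`**: the restriction to `Γ_K` of the (surjective)
`ℤ_p`-character of `Γ_ℚ` (`Gal(ℚ̃/ℚ) ≃ ℤ_p`, the tree's `zpRank_eq_nrComplexPlaces_add_one_rat`, from
Kronecker–Weber) is invariant under the lift `θ` of conjugation by any `c ∈ Γ_ℚ` (abelian target) and
is non-trivial, because `res(Γ_K)` together with `c · res(Γ_K)` exhausts `Γ_ℚ` (`c ∉ res(Γ_K)`,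
`c² = 1`, index two) and `ℤ_p` has no `2`-torsion. [cite: Washington1997, §13.1 and Thm. 13.4] -/
theorem exists_invariant_ne_one (hK : Module.finrank ℚ K = 2) {c : absoluteGaloisGroup ℚ}
    (hc : c ∉ Set.range (absGaloisRestrict ℚ K)) (hc2 : c * c = 1)
    {θ : absoluteGaloisGroup K →ₜ* absoluteGaloisGroup K}
    (hθ : ∀ σ, absGaloisRestrict ℚ K (θ σ) = c * absGaloisRestrict ℚ K σ * c⁻¹) :
    ∃ gp : absoluteGaloisGroup K →ₜ* Multiplicative ℤ_[p], gp ≠ 1 ∧ ∀ σ, gp (θ σ) = gp σ := by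
  classical
  obtain ⟨Φ, hsurj, -⟩ := zpRank_eq_nrComplexPlaces_add_one_rat p units_rank_rat
  let i₀ : Fin (nrComplexPlaces ℚ + 1) := ⟨0, Nat.succ_pos _⟩
  set F : absoluteGaloisGroup ℚ →ₜ* Multiplicative ℤ_[p] := Φ i₀ with hF
  have hFsurj : Function.Surjective F := fun y => by
    obtain ⟨ρ, hρ⟩ := hsurj (fun _ => y.toAdd)
    exact ⟨ρ, Multiplicative.toAdd.injective (congrFun hρ i₀)⟩
  refine ⟨F.comp (absGaloisRestrict ℚ K), ?_, fun σ => ?_⟩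
  · intro h1
    have hres : ∀ σ, F (absGaloisRestrict ℚ K σ) = 1 := fun σ => DFunLike.congr_fun h1 σ
    have hidx : ∀ ρ ρ' : absoluteGaloisGroup ℚ, ρ ∉ Set.range (absGaloisRestrict ℚ K) →
        ρ' ∉ Set.range (absGaloisRestrict ℚ K) → ρ⁻¹ * ρ' ∈ Set.range (absGaloisRestrict ℚ K) :=
      fun ρ ρ' hρ hρ' => inv_mul_mem_range_absGaloisRestrict hK hρ hρ'
    have hFc : F c = 1 := by
      have h2 : F c * F c = 1 := by rw [← map_mul, hc2, map_one]
      have h3 : (2 : ℤ_[p]) * (F c).toAdd = 0 := by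
        have := congrArg Multiplicative.toAdd h2
        rw [toAdd_mul, toAdd_one] at this
        linear_combination this
      exact Multiplicative.toAdd.injective
        (by rw [toAdd_one]; exact (mul_eq_zero.mp h3).resolve_left two_ne_zero)
    have hall : ∀ ρ, F ρ = 1 := fun ρ => by
      rcases IndexTwo.eq_res_or_eq_mul_res hc hc2 hidx ρ with ⟨α, rfl⟩ | ⟨α, rfl⟩
      · exact hres α
      · rw [map_mul, hFc, hres α, one_mul]
    obtain ⟨ρ, hρ⟩ := hFsurj (Multiplicative.ofAdd 1)
    rw [hall ρ] at hρ
    exact one_ne_zero (α := ℤ_[p]) (by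
      have := congrArg Multiplicative.toAdd hρ
      rw [toAdd_one, toAdd_ofAdd] at this
      exact this.symm)
  · show F (absGaloisRestrict ℚ K (θ σ)) = F (absGaloisRestrict ℚ K σ)
    rw [hθ, map_mul, map_mul, map_inv, mul_inv_cancel_comm]

/-- **LEMMA Λ′ for `Γ_K` (number-field form).** Let `K` be imaginary quadratic, `κ` an anticyclotomic
`ℤ_p`-extension, `c ∈ Γ_ℚ ∖ res(Γ_K)` an involution with lift `θ` of its conjugation to `Γ_K`, and
`Φ₀, Φ₁` a jointly surjective spanning pair of `Hom_cont(Γ_K, ℤ_p)`. Then for `σ ∈ ker κ`: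
`Φ₀(θσ) = Φ₀(σ)` and `Φ₁(θσ) = Φ₁(σ)` — complex conjugation acts trivially on `Gal(K̃_∞/K_∞^{ac})`.
(`κ∘θ = κ⁻¹` is the definition of `IsAnticyclotomic` at `ρ = c`; `θ∘θ = id` by
`IndexTwo.conjHom_conjHom`; the invariant non-zero class is `exists_invariant_ne_one`.)
[cite: Greenberg1987, §2] [cite: Washington1997, Thm. 13.4] -/
theorem apply_conj_eq_of_apply_eq_one (hK : Module.finrank ℚ K = 2) (κ : ZpExtension K p)
    (hκ : κ.IsAnticyclotomic) {c : absoluteGaloisGroup ℚ} (hc : c ∉ Set.range (absGaloisRestrict ℚ K))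
    (hc2 : c * c = 1) {θ : absoluteGaloisGroup K →ₜ* absoluteGaloisGroup K}
    (hθ : ∀ σ, absGaloisRestrict ℚ K (θ σ) = c * absGaloisRestrict ℚ K σ * c⁻¹)
    {Φ₀ Φ₁ : absoluteGaloisGroup K →ₜ* Multiplicative ℤ_[p]}
    (hsurj : Function.Surjective fun σ => ((Φ₀ σ).toAdd, (Φ₁ σ).toAdd))
    (hspan : ∀ f : absoluteGaloisGroup K →ₜ* Multiplicative ℤ_[p], ∃ a b : ℤ_[p],
      ∀ σ, (f σ).toAdd = a * (Φ₀ σ).toAdd + b * (Φ₁ σ).toAdd)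
    {σ : absoluteGaloisGroup K} (hσ : κ σ = 1) : Φ₀ (θ σ) = Φ₀ σ ∧ Φ₁ (θ σ) = Φ₁ σ := by
  haveI : Algebra.IsAlgebraic ℚ K := Algebra.IsAlgebraic.of_finite ℚ K
  have hinj : Function.Injective (absGaloisRestrict ℚ K) := absGaloisRestrict_injective ℚ K
  have hθθ : ∀ τ, θ (θ τ) = τ := IndexTwo.conjHom_conjHom hinj hc2 hθ
  have hκθ : ∀ τ, κ.toContinuousMonoidHom (θ τ) = (κ.toContinuousMonoidHom τ)⁻¹ :=
    fun τ => hκ τ (θ τ) c hc (hθ τ)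
  obtain ⟨gp, hgp, hgpθ⟩ := exists_invariant_ne_one (p := p) hK hc hc2 hθ
  exact apply_conj_eq_of_apply_eq_one_core θ hθθ Φ₀ Φ₁ hsurj hspan κ.toContinuousMonoidHom
    κ.surjective hκθ gp hgp hgpθ hσ

/-- **LEMMA Λ′ (number-field form): anti-invariant homomorphisms through `K̃_∞` square to `1` on
`Gal(K̄/K_∞^{ac})`.** Same setting; `g : Γ_K →* M` any group homomorphism killing `ker Φ₀ ∩ ker Φ₁`
with `g(θσ) = g(σ)⁻¹`. Then `g(σ)² = 1` for every `σ ∈ ker κ`. [cite: Greenberg1987, §2] -/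
theorem mul_self_eq_one_of_anti (hK : Module.finrank ℚ K = 2) (κ : ZpExtension K p)
    (hκ : κ.IsAnticyclotomic) {c : absoluteGaloisGroup ℚ} (hc : c ∉ Set.range (absGaloisRestrict ℚ K))
    (hc2 : c * c = 1) {θ : absoluteGaloisGroup K →ₜ* absoluteGaloisGroup K}
    (hθ : ∀ σ, absGaloisRestrict ℚ K (θ σ) = c * absGaloisRestrict ℚ K σ * c⁻¹)
    {Φ₀ Φ₁ : absoluteGaloisGroup K →ₜ* Multiplicative ℤ_[p]}
    (hsurj : Function.Surjective fun σ => ((Φ₀ σ).toAdd, (Φ₁ σ).toAdd))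
    (hspan : ∀ f : absoluteGaloisGroup K →ₜ* Multiplicative ℤ_[p], ∃ a b : ℤ_[p],
      ∀ σ, (f σ).toAdd = a * (Φ₀ σ).toAdd + b * (Φ₁ σ).toAdd)
    {M : Type*} [Group M] (g : absoluteGaloisGroup K →* M)
    (hN : ∀ σ, Φ₀ σ = 1 → Φ₁ σ = 1 → g σ = 1) (hanti : ∀ σ, g (θ σ) = (g σ)⁻¹)
    {σ : absoluteGaloisGroup K} (hσ : κ σ = 1) : g σ * g σ = 1 := by
  obtain ⟨h₀, h₁⟩ := apply_conj_eq_of_apply_eq_one hK κ hκ hc hc2 hθ hsurj hspan hσ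
  have hn : g (θ σ * σ⁻¹) = 1 :=
    hN _ (by rw [map_mul, map_inv, h₀, mul_inv_cancel]) (by rw [map_mul, map_inv, h₁, mul_inv_cancel])
  rw [map_mul, map_inv, hanti, ← mul_inv_rev, inv_eq_one] at hn
  exact hn

/-- **LEMMA Λ′ ⇒ `FactorsThroughZp`**: if moreover every value of `g` on `ker κ` lies in a set `P`
in which `x·x = 1 ⇒ x = 1` (the principal units of `ℚ̄_p`, `p` odd, are such a set), then `g`
kills `ker κ` — the shape `∀ σ, κ σ = 1 → g σ = 1` of `FactorsThroughZp κ`. [cite: Greenberg1987, §2] -/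
theorem apply_eq_one_of_anti (hK : Module.finrank ℚ K = 2) (κ : ZpExtension K p)
    (hκ : κ.IsAnticyclotomic) {c : absoluteGaloisGroup ℚ} (hc : c ∉ Set.range (absGaloisRestrict ℚ K))
    (hc2 : c * c = 1) {θ : absoluteGaloisGroup K →ₜ* absoluteGaloisGroup K}
    (hθ : ∀ σ, absGaloisRestrict ℚ K (θ σ) = c * absGaloisRestrict ℚ K σ * c⁻¹)
    {Φ₀ Φ₁ : absoluteGaloisGroup K →ₜ* Multiplicative ℤ_[p]}
    (hsurj : Function.Surjective fun σ => ((Φ₀ σ).toAdd, (Φ₁ σ).toAdd))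
    (hspan : ∀ f : absoluteGaloisGroup K →ₜ* Multiplicative ℤ_[p], ∃ a b : ℤ_[p],
      ∀ σ, (f σ).toAdd = a * (Φ₀ σ).toAdd + b * (Φ₁ σ).toAdd)
    {M : Type*} [Group M] (g : absoluteGaloisGroup K →* M)
    (hN : ∀ σ, Φ₀ σ = 1 → Φ₁ σ = 1 → g σ = 1) (hanti : ∀ σ, g (θ σ) = (g σ)⁻¹)
    (P : Set M) (hP : ∀ x ∈ P, x * x = 1 → x = 1) (hgP : ∀ σ, κ σ = 1 → g σ ∈ P)
    (σ : absoluteGaloisGroup K) (hσ : κ σ = 1) : g σ = 1 :=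
  hP _ (hgP σ hσ) (mul_self_eq_one_of_anti hK κ hκ hc hc2 hθ hsurj hspan g hN hanti hσ)

end NumberField

end Summit.BirchSwinnertonDyer.Rank1Residual.X11b.Three.LambdaSupply

end
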